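import Mathlib
import Summits.NavierStokesRegularity.NavierStokesRegularity.Theorems.FilamentSkeletonRssClause13ModelPieces
import Summits.NavierStokesRegularity.NavierStokesRegularity.Theorems.FilamentSkeletonRssClause13ModelPiecesCommute
import Summits.NavierStokesRegularity.NavierStokesRegularity.Theorems.FilamentSkeletonRssClause13ModelMourre

/-!
# Clause 13-J/13-R, brick n3 LAYER B (PIECES vs. THE OPERATOR): `𝓛(k∗Y) = k∗(𝓛Y) + [k∗,w]∂-term − [k∗,β₁]-term − [k∗,β₂]conj-term`

Route `FilamentSkeletonRss`, ∃-side clause 13 (`Clause13RNearStraightL` stmt-NavierStokesRegularity-23612; typing-agnostic); design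
`filament-plan/DESIGN-28296-model-gluing-g16(-v2-addendum).md` §2 / task B3.  For the full 1-D model operator
`𝓛Y = iG·((2/q)Y − K_q∗Y) − w·Y′ + β₁·Y + β₂·conj Y` and a cut-off piece `P = k∗Y` (`k` real, continuous, bounded, `k ∈ L¹`; `Y ∈ C¹_c`):

  `(𝓛P)(x) = (k∗𝓛Y)(x) + ∫k(x−y)(w(y)−w(x))Y′(y)dy − ∫k(x−y)(β₁(y)−β₁(x))Y(y)dy − ∫k(x−y)(β₂(y)−β₂(x))conj Y(y)dy`

(`pieceOperator_eq`), using `K_q∗(k∗Y) = k∗(K_q∗Y)` (`conv_conv_comm`, p699990), `P′ = k∗Y′` (`hasDerivAt_piece`, p699582) and `conj(k∗Y) = k∗conj Y`.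
The three correction terms are exactly those bounded in `L²` by `…Clause13CutoffCommutator` (p693953: `Λ(‖t k′‖₁+‖k‖₁)‖Y‖₂`, `L_β‖t k‖₁‖Y‖₂`) and refined in
p697060.  Auxiliary: `integrable_kernel_mul_smoothing_piece` (`k(x−·)·(K_q∗Y)` is integrable: `K_q∗Y` is bounded by `2q^{-3/2}‖Y‖₁`),
`norm_smoothingPiece_le`.
Lane ns-filament-19175-p1 g16; `--supports stmt-NavierStokesRegularity-23612 --as helper`.
HONEST FRAMING: bookkeeping about an explicit 1-D model operator attached to a HYPOTHETICAL filament skeleton on the NEGATIVE side of a MODEL route;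
nothing here bears on Navier–Stokes regularity or blow-up.
-/

noncomputable section

open MeasureTheory Real Complex Filter Set
open scoped ComplexConjugate Topology

namespace Summit.NavierStokesRegularity.NavierStokesRegularity.Theorems.MatchedKernel
set_option linter.dupNamespace false

/-- The real smoothing kernel `K_q(s) = (2q − s²)(s²+q)^{-5/2}` is integrable. [folklore] -/
theorem integrable_smoothingKernel_real {q : ℝ} (hq : 0 < q) :
    Integrable fun s : ℝ => (2 * q - s ^ 2) * ((s ^ 2 + q) ^ (5 / 2 : ℝ))⁻¹ := by
  have h := (integrable_smoothingKernel hq).re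
  refine h.congr (ae_of_all _ fun s => ?_)
  simp only [RCLike.re_to_complex, Complex.ofReal_re]

/-- `K_q∗Y` is bounded: `‖(K_q∗Y)(τ)‖ ≤ 2q^{-3/2}·∫‖Y‖`. [folklore] -/
theorem norm_smoothingPiece_le {q : ℝ} (hq : 0 < q) {Y : ℝ → ℂ} (hYc : Continuous Y) (hYs : HasCompactSupport Y) (τ : ℝ) :
    ‖∫ σ : ℝ, ((((2 * q - (τ - σ) ^ 2) * (((τ - σ) ^ 2 + q) ^ (5 / 2 : ℝ))⁻¹ : ℝ)) : ℂ) * Y σ‖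
      ≤ 2 * (q ^ (3 / 2 : ℝ))⁻¹ * ∫ σ : ℝ, ‖Y σ‖ := by
  refine (norm_piece_le (k := fun s => (2 * q - s ^ 2) * ((s ^ 2 + q) ^ (5 / 2 : ℝ))⁻¹) (continuous_smoothingKernel hq) hYc hYs τ).trans ?_
  rw [← integral_const_mul]
  refine integral_mono_of_nonneg (ae_of_all _ fun σ => by positivity) ((hYc.integrable_of_hasCompactSupport hYs).norm.const_mul _)
    (ae_of_all _ fun σ => ?_)
  exact mul_le_mul_of_nonneg_right (abs_smoothingKernel_le_const hq _) (norm_nonneg _)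

/-- `K_q∗Y` is continuous. [folklore] -/
theorem continuous_smoothingPiece {q : ℝ} (hq : 0 < q) {Y : ℝ → ℂ} (hYc : Continuous Y) (hYs : HasCompactSupport Y) :
    Continuous fun τ : ℝ => ∫ σ : ℝ, ((((2 * q - (τ - σ) ^ 2) * (((τ - σ) ^ 2 + q) ^ (5 / 2 : ℝ))⁻¹ : ℝ)) : ℂ) * Y σ :=
  continuous_piece (k := fun s => (2 * q - s ^ 2) * ((s ^ 2 + q) ^ (5 / 2 : ℝ))⁻¹) (continuous_smoothingKernel hq) hYc hYs

/-- `y ↦ k(x−y)·(K_q∗Y)(y)` is integrable for `k ∈ L¹` continuous. [folklore] -/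
theorem integrable_kernel_mul_smoothingPiece {q : ℝ} (hq : 0 < q) {k : ℝ → ℝ} (hki : Integrable k)
    {Y : ℝ → ℂ} (hYc : Continuous Y) (hYs : HasCompactSupport Y) (x : ℝ) :
    Integrable fun y : ℝ => ((k (x - y) : ℝ) : ℂ) *
      ∫ σ : ℝ, ((((2 * q - (y - σ) ^ 2) * (((y - σ) ^ 2 + q) ^ (5 / 2 : ℝ))⁻¹ : ℝ)) : ℂ) * Y σ := by
  have hkx : Integrable (fun y : ℝ => ((k (x - y) : ℝ) : ℂ)) := (hki.comp_sub_left x).ofReal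
  have hB := continuous_smoothingPiece hq hYc hYs
  have h := hkx.bdd_mul hB.aestronglyMeasurable (c := 2 * (q ^ (3 / 2 : ℝ))⁻¹ * ∫ σ : ℝ, ‖Y σ‖)
    (ae_of_all _ fun y => norm_smoothingPiece_le hq hYc hYs y)
  refine h.congr (ae_of_all _ fun y => ?_)
  simp only [mul_comm]

/-- **THE PIECE–OPERATOR IDENTITY.**  Let `q > 0`, `G : ℝ`; `k` real, continuous, bounded (`|k| ≤ Mk`), integrable; `Y ∈ C¹` with compact support; `w` real
continuous; `β₁, β₂` measurable and bounded.  With `P(x) = ∫k(x−y)Y(y)dy`, `P′(x) = ∫k(x−y)Y′(y)dy` (`hasDerivAt_piece`), `K_qf(τ) = ∫K_q(τ−σ)f(σ)dσ` and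
`𝓛f = iG((2/q)f − K_qf) − w f′ + β₁f + β₂conj f`:
`𝓛P(x) = ∫k(x−y)(𝓛Y)(y)dy + ∫k(x−y)(w(y)−w(x))Y′(y)dy − ∫k(x−y)(β₁(y)−β₁(x))Y(y)dy − ∫k(x−y)(β₂(y)−β₂(x))conj Y(y)dy`. [folklore] -/
theorem pieceOperator_eq {q G : ℝ} (hq : 0 < q) {k : ℝ → ℝ} (hkc : Continuous k) (hki : Integrable k) {Mk : ℝ} (hkM : ∀ t, |k t| ≤ Mk)
    {Y : ℝ → ℂ} (hY : ContDiff ℝ 1 Y) (hYs : HasCompactSupport Y)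
    {w : ℝ → ℝ} (hwc : Continuous w) {β₁ β₂ : ℝ → ℂ} (hβ₁m : AEStronglyMeasurable β₁ volume) (hβ₂m : AEStronglyMeasurable β₂ volume)
    {b₁ b₂ : ℝ} (hb₁ : ∀ τ, ‖β₁ τ‖ ≤ b₁) (hb₂ : ∀ τ, ‖β₂ τ‖ ≤ b₂) (x : ℝ) :
    I * (G : ℂ) * ((2 / q : ℂ) * (∫ y : ℝ, ((k (x - y) : ℝ) : ℂ) * Y y)
        - ∫ σ : ℝ, ((((2 * q - (x - σ) ^ 2) * (((x - σ) ^ 2 + q) ^ (5 / 2 : ℝ))⁻¹ : ℝ)) : ℂ) * ∫ y : ℝ, ((k (σ - y) : ℝ) : ℂ) * Y y)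
      - ((w x : ℝ) : ℂ) * (∫ y : ℝ, ((k (x - y) : ℝ) : ℂ) * deriv Y y)
      + β₁ x * (∫ y : ℝ, ((k (x - y) : ℝ) : ℂ) * Y y) + β₂ x * conj (∫ y : ℝ, ((k (x - y) : ℝ) : ℂ) * Y y)
    = (∫ y : ℝ, ((k (x - y) : ℝ) : ℂ) *
          (I * (G : ℂ) * ((2 / q : ℂ) * Y y - ∫ σ : ℝ, ((((2 * q - (y - σ) ^ 2) * (((y - σ) ^ 2 + q) ^ (5 / 2 : ℝ))⁻¹ : ℝ)) : ℂ) * Y σ)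
            - ((w y : ℝ) : ℂ) * deriv Y y + β₁ y * Y y + β₂ y * conj (Y y)))
      + (∫ y : ℝ, ((k (x - y) * (w y - w x) : ℝ) : ℂ) * deriv Y y)
      - (∫ y : ℝ, ((k (x - y) : ℝ) : ℂ) * (β₁ y - β₁ x) * Y y)
      - ∫ y : ℝ, ((k (x - y) : ℝ) : ℂ) * (β₂ y - β₂ x) * conj (Y y) := by
  have hYc : Continuous Y := hY.continuous
  have hY'c : Continuous (deriv Y) := hY.continuous_deriv le_rfl
  have hY's : HasCompactSupport (deriv Y) := hYs.deriv
  set Kq : ℝ → ℝ := fun s => (2 * q - s ^ 2) * ((s ^ 2 + q) ^ (5 / 2 : ℝ))⁻¹ with hKq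
  -- integrability of the five `k(x−·)`-weighted terms
  have hI0 : Integrable (fun y : ℝ => ((k (x - y) : ℝ) : ℂ) * Y y) := integrable_piece_integrand hkc hYc hYs x
  have hIK : Integrable (fun y : ℝ => ((k (x - y) : ℝ) : ℂ) *
      ∫ σ : ℝ, ((((2 * q - (y - σ) ^ 2) * (((y - σ) ^ 2 + q) ^ (5 / 2 : ℝ))⁻¹ : ℝ)) : ℂ) * Y σ) :=
    integrable_kernel_mul_smoothingPiece hq hki hYc hYs x
  have hIw : Integrable (fun y : ℝ => ((k (x - y) : ℝ) : ℂ) * (((w y : ℝ) : ℂ) * deriv Y y)) :=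
    ((Complex.continuous_ofReal.comp (hkc.comp (continuous_const.sub continuous_id))).mul
      ((Complex.continuous_ofReal.comp hwc).mul hY'c)).integrable_of_hasCompactSupport (hY's.mul_left).mul_left
  have hkxm : AEStronglyMeasurable (fun y : ℝ => ((k (x - y) : ℝ) : ℂ)) volume :=
    (Complex.continuous_ofReal.comp (hkc.comp (continuous_const.sub continuous_id))).aestronglyMeasurable
  have hI1 : Integrable (fun y : ℝ => ((k (x - y) : ℝ) : ℂ) * (β₁ y * Y y)) := by
    have h := (hI0.bdd_mul hβ₁m (c := b₁) (ae_of_all _ hb₁))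
    refine h.congr (ae_of_all _ fun y => ?_); simp only; ring
  have hI2 : Integrable (fun y : ℝ => ((k (x - y) : ℝ) : ℂ) * (β₂ y * conj (Y y))) := by
    have h0 : Integrable (fun y : ℝ => ((k (x - y) : ℝ) : ℂ) * conj (Y y)) :=
      integrable_piece_integrand hkc (Complex.continuous_conj.comp hYc) (hYs.comp_left (g := conj) (map_zero _)) x
    have h := (h0.bdd_mul hβ₂m (c := b₂) (ae_of_all _ hb₂))
    refine h.congr (ae_of_all _ fun y => ?_); simp only; ring
  -- expand `k∗(𝓛Y)` into its five integrals
  have hsplit : ∫ y : ℝ, ((k (x - y) : ℝ) : ℂ) *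
        (I * (G : ℂ) * ((2 / q : ℂ) * Y y - ∫ σ : ℝ, ((((2 * q - (y - σ) ^ 2) * (((y - σ) ^ 2 + q) ^ (5 / 2 : ℝ))⁻¹ : ℝ)) : ℂ) * Y σ)
          - ((w y : ℝ) : ℂ) * deriv Y y + β₁ y * Y y + β₂ y * conj (Y y))
      = I * (G : ℂ) * (2 / q : ℂ) * (∫ y : ℝ, ((k (x - y) : ℝ) : ℂ) * Y y)
        - I * (G : ℂ) * (∫ y : ℝ, ((k (x - y) : ℝ) : ℂ) *
            ∫ σ : ℝ, ((((2 * q - (y - σ) ^ 2) * (((y - σ) ^ 2 + q) ^ (5 / 2 : ℝ))⁻¹ : ℝ)) : ℂ) * Y σ)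
        - (∫ y : ℝ, ((k (x - y) : ℝ) : ℂ) * (((w y : ℝ) : ℂ) * deriv Y y))
        + (∫ y : ℝ, ((k (x - y) : ℝ) : ℂ) * (β₁ y * Y y))
        + ∫ y : ℝ, ((k (x - y) : ℝ) : ℂ) * (β₂ y * conj (Y y)) := by
    have e : (fun y : ℝ => ((k (x - y) : ℝ) : ℂ) *
        (I * (G : ℂ) * ((2 / q : ℂ) * Y y - ∫ σ : ℝ, ((((2 * q - (y - σ) ^ 2) * (((y - σ) ^ 2 + q) ^ (5 / 2 : ℝ))⁻¹ : ℝ)) : ℂ) * Y σ)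
          - ((w y : ℝ) : ℂ) * deriv Y y + β₁ y * Y y + β₂ y * conj (Y y)))
        = fun y : ℝ => (((I * (G : ℂ) * (2 / q : ℂ) * (((k (x - y) : ℝ) : ℂ) * Y y)
          - I * (G : ℂ) * (((k (x - y) : ℝ) : ℂ) *
              ∫ σ : ℝ, ((((2 * q - (y - σ) ^ 2) * (((y - σ) ^ 2 + q) ^ (5 / 2 : ℝ))⁻¹ : ℝ)) : ℂ) * Y σ))
          - ((k (x - y) : ℝ) : ℂ) * (((w y : ℝ) : ℂ) * deriv Y y))
          + ((k (x - y) : ℝ) : ℂ) * (β₁ y * Y y))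
          + ((k (x - y) : ℝ) : ℂ) * (β₂ y * conj (Y y)) := by
      funext y; ring
    rw [e, integral_add, integral_add, integral_sub, integral_sub, integral_const_mul, integral_const_mul]
    · exact hI0.const_mul _
    · exact hIK.const_mul _
    · exact (hI0.const_mul _).sub (hIK.const_mul _)
    · exact hIw
    · exact ((hI0.const_mul _).sub (hIK.const_mul _)).sub hIw
    · exact hI1
    · exact (((hI0.const_mul _).sub (hIK.const_mul _)).sub hIw).add hI1
    · exact hI2
  -- the self terms agree: `K_q∗(k∗Y) = k∗(K_q∗Y)`
  have hcomm := conv_conv_comm (K := Kq) (continuous_smoothingKernel hq) (integrable_smoothingKernel_real hq)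
    (fun t => abs_smoothingKernel_le_const hq t) hkc hki hkM hYc hYs x
  -- the three commutator integrals split
  have hTw : ∫ y : ℝ, ((k (x - y) * (w y - w x) : ℝ) : ℂ) * deriv Y y
      = (∫ y : ℝ, ((k (x - y) : ℝ) : ℂ) * (((w y : ℝ) : ℂ) * deriv Y y)) - ((w x : ℝ) : ℂ) * ∫ y : ℝ, ((k (x - y) : ℝ) : ℂ) * deriv Y y := by
    have hI' : Integrable (fun y : ℝ => ((k (x - y) : ℝ) : ℂ) * deriv Y y) := integrable_piece_integrand hkc hY'c hY's x
    rw [← integral_const_mul, ← integral_sub hIw (hI'.const_mul _)]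
    refine integral_congr_ae (ae_of_all _ fun y => ?_); push_cast; ring
  have hM1 : ∫ y : ℝ, ((k (x - y) : ℝ) : ℂ) * (β₁ y - β₁ x) * Y y
      = (∫ y : ℝ, ((k (x - y) : ℝ) : ℂ) * (β₁ y * Y y)) - β₁ x * ∫ y : ℝ, ((k (x - y) : ℝ) : ℂ) * Y y := by
    rw [← integral_const_mul, ← integral_sub hI1 (hI0.const_mul _)]
    refine integral_congr_ae (ae_of_all _ fun y => ?_); simp only; ring
  have hM2 : ∫ y : ℝ, ((k (x - y) : ℝ) : ℂ) * (β₂ y - β₂ x) * conj (Y y)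
      = (∫ y : ℝ, ((k (x - y) : ℝ) : ℂ) * (β₂ y * conj (Y y))) - β₂ x * ∫ y : ℝ, ((k (x - y) : ℝ) : ℂ) * conj (Y y) := by
    have h0 : Integrable (fun y : ℝ => ((k (x - y) : ℝ) : ℂ) * conj (Y y)) :=
      integrable_piece_integrand hkc (Complex.continuous_conj.comp hYc) (hYs.comp_left (g := conj) (map_zero _)) x
    rw [← integral_const_mul, ← integral_sub hI2 (h0.const_mul _)]
    refine integral_congr_ae (ae_of_all _ fun y => ?_); simp only; ring
  rw [hsplit, hTw, hM1, hM2, conj_piece, hKq] at *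
  rw [show (∫ σ : ℝ, ((((2 * q - (x - σ) ^ 2) * (((x - σ) ^ 2 + q) ^ (5 / 2 : ℝ))⁻¹ : ℝ)) : ℂ) * ∫ y : ℝ, ((k (σ - y) : ℝ) : ℂ) * Y y)
      = ∫ y : ℝ, ((k (x - y) : ℝ) : ℂ) * ∫ σ : ℝ, ((((2 * q - (y - σ) ^ 2) * (((y - σ) ^ 2 + q) ^ (5 / 2 : ℝ))⁻¹ : ℝ)) : ℂ) * Y σ
      from hcomm]
  ring

end Summit.NavierStokesRegularity.NavierStokesRegularity.Theorems.MatchedKernel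

end
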